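import Mathlib
import HarnessLib
import Summits.HubbardSuperconductivity.HubbardSuperconductivity.Theorems.KLProgrammeKLRegimeSplitEdgeFactsComplFamily

/-!
# Route `KLProgramme` — ENGINE child gen 8 (stmt-HubbardSuperconductivity-20437 `KLRegimeEngineV17F2`), skeleton v2 class #5 «(S)-transfer» rev 3 (RELATIVE family):
# the CUTOFF-BUILT index — `IsCutoffBuilt`, `PairTransferRelFamilyCB` (plan g21 (R54x): PICK OF RECORD «cutoff-built», clauses = p1 g13 KL STATUS l.4240 §1;
# cell gate-hubbard-kl, seat hubbard-kl-k3c1-p1 g10 = the ONE WRITER per (R54x)(3); text owner p1)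

WHY.  `PairTransferRelFamily … n TB` (p585429) quantifies over ALL ordered admissible pairs of the frame `Kₙ`; that wide family is not reachable by the planned
induction (`pairTransferRelAt_succ`, p586440): a generic admissible pair at `(Kₙ, n)` has no admissible HISTORY pair at `(K_{n−1}, n−1)` (admissibility is
frame-dependent), and a bare radial-profile index is not frame-robust on the finite torus either (p1's counterexample: the indicator of the finite value set
`{ω_k² + e_{Kₙ}(k)²}`).  The family the induction DOES close on, and the only one any consumer reads, is the COMPLEMENTARY family `s^K_{n,m} = w^K_{Λ_m} − w^K_{Λₙ}`,
`m ≥ n`: frame-covariant datum = the index `m` (re-framing = same `m`, new `K`); step-closed by the identity `s^K_{n+1,m} + s^K_{n,n+1} = s^K_{n,m}` in EVERY frame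
(`softSymbolCompl_succ_add_slice`, p1 `…SplitEdgeFactsComplFamily`): the history pair of `(s_{n+1,m} | s_{n+1,m′})` is `(s_{n,m} | s_{n,m′})` — same `(m, m′)`, one unit
of `n` less; consumer-complete: `m = n` is the PLAIN member `0` (`softSymbolCompl_self`), `m > nScales β` the WICK member `1 − w^K_{Λₙ}`
(`softSymbolCompl_eq_one_sub_of_nScales_lt`), step 3 reads `(s_{n,n+1} | 0)`; every member is RADIAL with the explicit Gevrey profile (`softSymbolCompl_eq_profile`), so
the floor slot of the bar of record (`transferBarRelAtF`, p586991) is sound on the whole family; and `IsCutoffBuilt → IsSoftSymbol`, so every lemma of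
p585429/p580182/p583823/p586307 applies verbatim.
* (D1) `IsCutoffBuilt L M β μ K n ψ := ∃ m, n ≤ m ∧ ψ = softSymbolCompl L M β μ K n m`; (L1) `IsCutoffBuilt.isSoftSymbol`; `isCutoffBuilt_compl`, `isCutoffBuilt_zero`.
* (D2) `PairTransferRelFamilyCB L M β U μ n TB` (= `PairTransferRelFamily` with `IsSoftSymbol ↦ IsCutoffBuilt`; ordered pairs; `TB` a parameter, same arity);
  (L2) `PairTransferRelFamily.restrict`, `PairTransferRelFamilyCB.mono`; (L3) **`PairTransferRelFamilyCB.pinnedAt`** (⇒ rev 2's `PairTransferPinnedAt … n ψ` for a cutoff-built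
  `ψ` given `TB ψ 0 ≤ transferBarAt … n`), `.pinnedAt_compl`; (L4) **`pairTransferRelFamilyCB_iff`** (the index form over `n ≤ m′ ≤ m`).
Definitions with bodies + bookkeeping lemmas; nothing about the model is asserted.  0 kit.
-/

noncomputable section

namespace Summit.HubbardSuperconductivity.HubbardSuperconductivity.Theorems.KLRegimeSplit

set_option linter.dupNamespace false -- summit = problem name (single-conjunct summit), D-0017

open Real Finset Literature.MathematicalPhysics.QuantumLattice Literature.Probability.LatticeModels
open Summit.HubbardSuperconductivity.HubbardSuperconductivity.Theorems.KLProgrammeLegKernels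
open Summit.HubbardSuperconductivity.HubbardSuperconductivity.Theorems.DispersionFlow

/-! ## §1 The cutoff-built index -/

section Index

variable (L M : ℕ)

/-- **(D1) `IsCutoffBuilt L M β μ K n ψ`** — `ψ` is a member of the complementary family of the frame `K` at scale `n`: `ψ = s^K_{n,m} = w^K_{Λ_m} − w^K_{Λₙ}` for some
index `m ≥ n` (the frame-covariant construction datum). -/
def IsCutoffBuilt (β μ : ℝ) (K : TrigPolyC4v) (n : ℕ) (ψ : FreqMomentum L M → ℝ) : Prop :=
  ∃ m : ℕ, n ≤ m ∧ ψ = softSymbolCompl L M β μ K n m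

variable {L M} (β μ : ℝ) (K : TrigPolyC4v)

/-- Every complementary symbol `s_{n,m}`, `m ≥ n`, is cutoff-built. -/
theorem isCutoffBuilt_compl {n m : ℕ} (hnm : n ≤ m) : IsCutoffBuilt L M β μ K n (softSymbolCompl L M β μ K n m) := ⟨m, hnm, rfl⟩

/-- **The PLAIN member is cutoff-built**: `0 = s_{n,n}` (`m := n`). -/
theorem isCutoffBuilt_zero (n : ℕ) : IsCutoffBuilt L M β μ K n (fun _ => 0) := ⟨n, le_rfl, (softSymbolCompl_self β μ K n).symm⟩

variable {β μ K}

/-- **(L1)** cutoff-built symbols are admissible (`isSoftSymbol_compl`). -/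
theorem IsCutoffBuilt.isSoftSymbol {n : ℕ} {ψ : FreqMomentum L M → ℝ} (h : IsCutoffBuilt L M β μ K n ψ) : IsSoftSymbol L M β μ K n ψ := by
  obtain ⟨m, hnm, rfl⟩ := h
  exact isSoftSymbol_compl β μ K hnm

/-- The HISTORY member: if `ψ = s^K_{n+1,m}` is cutoff-built at scale `n+1` then `ψ + s^K_{n,n+1} = s^K_{n,m}` is cutoff-built at scale `n` (same frame `K`; the same
index `m` at any other frame is `isCutoffBuilt_compl`). -/
theorem IsCutoffBuilt.add_slice {n : ℕ} {ψ : FreqMomentum L M → ℝ} (h : IsCutoffBuilt L M β μ K (n + 1) ψ) :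
    IsCutoffBuilt L M β μ K n (ψ + softSymbolCompl L M β μ K n (n + 1)) := by
  obtain ⟨m, hnm, rfl⟩ := h
  exact ⟨m, by omega, softSymbolCompl_succ_add_slice β μ K n m⟩

end Index

/-! ## §2 The cutoff-built relative family -/

section Family

variable (L M : ℕ) [NeZero L] [NeZero M]

/-- **(D2) `PairTransferRelFamilyCB L M β U μ n TB`** — the relative transfer clause at every ORDERED pair of CUTOFF-BUILT members of the flowing frame `Kₙ` at scale `n`
(`ψ₂ ≤ ψ₁` pointwise), with the pair-dependent bar `TB` (a parameter; the bar of record is `transferBarRelAtF …`).  The class-#5 rev-3 invariant the step Prop carries. -/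
def PairTransferRelFamilyCB (β U μ : ℝ) (n : ℕ)
    (TB : (FreqMomentum L M → ℝ) → (FreqMomentum L M → ℝ) → TorusSite 2 L → TorusSite 2 L → TorusSite 2 L → ℝ) : Prop :=
  ∀ ψ₁ ψ₂ : FreqMomentum L M → ℝ, IsCutoffBuilt L M β μ (klFlowFrameU L M β U μ n) n ψ₁ → IsCutoffBuilt L M β μ (klFlowFrameU L M β U μ n) n ψ₂ →
    (∀ k, ψ₂ k ≤ ψ₁ k) → PairTransferRelAt L M β U μ n (TB ψ₁ ψ₂) ψ₁ ψ₂

variable {L M}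

/-- **(L2)** the wide family (all ordered admissible pairs) restricts to the cutoff-built one. -/
theorem PairTransferRelFamily.restrict {β U μ : ℝ} {n : ℕ}
    {TB : (FreqMomentum L M → ℝ) → (FreqMomentum L M → ℝ) → TorusSite 2 L → TorusSite 2 L → TorusSite 2 L → ℝ} (h : PairTransferRelFamily L M β U μ n TB) :
    PairTransferRelFamilyCB L M β U μ n TB := fun _ _ h₁ h₂ hle => h _ _ h₁.isSoftSymbol h₂.isSoftSymbol hle

/-- Monotonicity of the cutoff-built family in the bar. -/
theorem PairTransferRelFamilyCB.mono {β U μ : ℝ} {n : ℕ}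
    {TB TB' : (FreqMomentum L M → ℝ) → (FreqMomentum L M → ℝ) → TorusSite 2 L → TorusSite 2 L → TorusSite 2 L → ℝ}
    (h : PairTransferRelFamilyCB L M β U μ n TB) (hle : ∀ ψ₁ ψ₂ Qm k k', TB ψ₁ ψ₂ Qm k k' ≤ TB' ψ₁ ψ₂ Qm k k') : PairTransferRelFamilyCB L M β U μ n TB' :=
  fun ψ₁ ψ₂ h₁ h₂ hle' => (h ψ₁ ψ₂ h₁ h₂ hle').mono (hle _ _)

/-- **(L3) BRIDGE**: a cutoff-built `ψ` whose pair `(ψ | 0)` carries a bar dominated by `transferBarAt … n` gets rev 2's consumer clause `PairTransferPinnedAt … n ψ`. -/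
theorem PairTransferRelFamilyCB.pinnedAt {G : GeoConsts} {P : SplitConsts} {r β U μ : ℝ} {n : ℕ}
    {TB : (FreqMomentum L M → ℝ) → (FreqMomentum L M → ℝ) → TorusSite 2 L → TorusSite 2 L → TorusSite 2 L → ℝ} (h : PairTransferRelFamilyCB L M β U μ n TB)
    {ψ : FreqMomentum L M → ℝ} (hψ : IsCutoffBuilt L M β μ (klFlowFrameU L M β U μ n) n ψ)
    (hle : ∀ Qm k k', TB ψ (fun _ => 0) Qm k k' ≤ transferBarAt L G P r β U n Qm k k') : PairTransferPinnedAt L M G P r β U μ n ψ :=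
  pairTransferPinnedAt_of_rel (h ψ (fun _ => 0) hψ (isCutoffBuilt_zero β μ _ n) fun k => (hψ.isSoftSymbol.1 k).1) hle

/-- The complementary member `m ≥ n` (step 3 / the (c) closer read `m := n+1`). -/
theorem PairTransferRelFamilyCB.pinnedAt_compl {G : GeoConsts} {P : SplitConsts} {r β U μ : ℝ} {n m : ℕ} (hnm : n ≤ m)
    {TB : (FreqMomentum L M → ℝ) → (FreqMomentum L M → ℝ) → TorusSite 2 L → TorusSite 2 L → TorusSite 2 L → ℝ} (h : PairTransferRelFamilyCB L M β U μ n TB)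
    (hle : ∀ Qm k k', TB (softSymbolCompl L M β μ (klFlowFrameU L M β U μ n) n m) (fun _ => 0) Qm k k' ≤ transferBarAt L G P r β U n Qm k k') :
    PairTransferPinnedAt L M G P r β U μ n (softSymbolCompl L M β μ (klFlowFrameU L M β U μ n) n m) :=
  h.pinnedAt (isCutoffBuilt_compl β μ _ hnm) hle

/-- **(L4) INDEX FORM**: the cutoff-built family is the family of index pairs `n ≤ m′ ≤ m` — `(s_{n,m} | s_{n,m′})` (orderedness ⇔ `m′ ≤ m` up to equal members). -/
theorem pairTransferRelFamilyCB_iff {β U μ : ℝ} {n : ℕ}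
    {TB : (FreqMomentum L M → ℝ) → (FreqMomentum L M → ℝ) → TorusSite 2 L → TorusSite 2 L → TorusSite 2 L → ℝ} :
    PairTransferRelFamilyCB L M β U μ n TB ↔
      ∀ m m' : ℕ, n ≤ m' → m' ≤ m →
        PairTransferRelAt L M β U μ n
          (TB (softSymbolCompl L M β μ (klFlowFrameU L M β U μ n) n m) (softSymbolCompl L M β μ (klFlowFrameU L M β U μ n) n m'))
          (softSymbolCompl L M β μ (klFlowFrameU L M β U μ n) n m) (softSymbolCompl L M β μ (klFlowFrameU L M β U μ n) n m') := by
  constructor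
  · intro h m m' hm' hmm
    exact h _ _ (isCutoffBuilt_compl β μ _ (hm'.trans hmm)) (isCutoffBuilt_compl β μ _ hm') (softSymbolCompl_mono_index β μ _ n hmm)
  · rintro h ψ₁ ψ₂ ⟨m₁, hm₁, rfl⟩ ⟨m₂, hm₂, rfl⟩ hle
    rcases le_or_gt m₂ m₁ with hmm | hmm
    · exact h m₁ m₂ hm₂ hmm
    · -- reversed indices: the order hypothesis forces the two members to coincide
      have heq : softSymbolCompl L M β μ (klFlowFrameU L M β U μ n) n m₁ = softSymbolCompl L M β μ (klFlowFrameU L M β U μ n) n m₂ :=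
        funext fun k => le_antisymm (softSymbolCompl_mono_index β μ _ n hmm.le k) (hle k)
      rw [heq]
      exact h m₂ m₂ hm₂ le_rfl

end Family

end Summit.HubbardSuperconductivity.HubbardSuperconductivity.Theorems.KLRegimeSplit

end
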